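import Mathlib
import Summits.QuantumFields.Balaban3D.Carriers.Standard
import Summits.QuantumFields.Balaban3D.Proofs.LiftBridge
import Summits.QuantumFields.Balaban3D.Proofs.ScalesArithmetic

/-!
# `Summit.QuantumFields.Balaban3D.Proofs.LargeFieldStd` — lane «pub-balaban3d» (Bałaban, CMP **102** (1985) 255–275, d = 3 lattice
# UV stability AS PRINTED), prover seat p2: the large-field leaf `B10Assembly.LeafSystem.lf` AT THE LANE'S STANDARD TOWER INPUT
# `Carriers.stdTowerInput X K 𝔖` (seat p1 v1.3, rulings R-FL′/R-E4‴/R-32′) — LEAF-LEDGER row B25 with every carrier-side hypothesis discharged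

HONEST FRAMING (lane PLAN.md §0).  [B10] = [Balaban1985UV3]: UV stability of the d = 3 Wilson lattice gauge theory on a finite torus;
NOT a continuum limit, NOT d = 4, NOT the Clay problem.  Nothing of the paper is asserted.  This file takes the closing term
`…Proofs.LiftBridge.lf_tower3_avg` (the pp. 273–274 resummation with the collar count, the lift/bridge, the multiplicity, (69)–(71)
kernel-checked, (67) read on the lift) and DISCHARGES, for the standard tower input of the lane (the E4 family member
`towerWith (stdTowerInput X K 𝔖) ⊤`, whose `pin` is `tower3`), the hypotheses that are facts about the lane's DEFINITIONS: the
masses vanish off admissible histories (p1 `stdTowerInput_mass_eq_zero_of_not_admissible`); the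
collar profile `Rcol k = ⌈R₁ r(g_k)⌉M₁` (p1 `rcolOf`, (39) p. 266) is antitone along the flow and `≤ (R₁+1)M₁·x(g_k)^{r₀}` ON THE WINDOW
`k ≤ K` (§1); the booked Z-term coefficients `zcoefOf` ((41) p. 266) are `≥ 0` and `≤ A·x(g_j)` on the window (§2); `|T₁^{(k)}| = #T^{(k)}`,
`g_k = gRun 1 L (g²ε) k`, `0 < g_k ≤ 1` for `k ≤ K` (seat p3's `ScalesArithmetic`).  What remains (§3 `lf_stdTowerInput`): the two (α)
DATA DISPLAYS about the expansion datum `U_k(h,·)` — (67)∘large-field and (68), p. 273 —, the coupling window `g_j ≤ γ₇₁ᴸ`, sign/size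
facts of the constants record, and the three provisos NOT IN PRINT (`3r₀ + 2 ≤ 2p₀`, two `b₀`-thresholds; E2).
-/

noncomputable section

namespace Summit.QuantumFields.Balaban3D.Proofs.LargeFieldStd

open Literature.MathematicalPhysics.QuantumFieldTheory.Balaban1983to89
open Literature.MathematicalPhysics.QuantumFieldTheory.Balaban1985CMP102
open Literature.MathematicalPhysics.QuantumFieldTheory.Balaban1985CMP102.Setting
open Summit.QuantumFields.Balaban3D.Carriers
open Summit.QuantumFields.Balaban3D.Proofs.ScalesArithmetic (gk_pos gk_mono gk_le_one gk_eq_gRun_norm g0sq_pos sites_eq_card)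
open Summit.QuantumFields.Balaban3D.Proofs.LargeFieldKnit (bookedCZ_le_xlog)
open Summit.QuantumFields.Balaban3D.Proofs.LiftBridge (liftCfg lf_tower3_avg)
open Summit.QuantumFields.Balaban3D.Proofs.Run3SmallFactors (codeZ)
open Summit.QuantumFields.Balaban3D.Proofs.Thresholds (gamma71L)
open B7Prop1Explicit (hol plaqWord)
open B7Prop1Local (pdevOn loK plaqHiK)
open B7Prop2Explicit (avgIter)
open B10LargeField (xlog one_le_xlog rFun_eq)

variable {L : ℕ} {S : Scales L}

/-! ## §1 The collar profile `rcolOf` on the window `k ≤ K` -/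

/-- `r(g) = (1 + log g⁻¹)^{r₀}` is ANTITONE in `g` on `(0, 1]` for `r₀ ≥ 0`. [cite: Balaban1985UV3, (7) p.257] -/
theorem rFun_antitone {r₀ g g' : ℝ} (hr : 0 ≤ r₀) (hg : 0 < g) (hgg' : g ≤ g') (hg'1 : g' ≤ 1) :
    B10.rFun r₀ g' ≤ B10.rFun r₀ g := by
  rw [rFun_eq, rFun_eq]
  have hx' : 1 ≤ xlog g' := one_le_xlog (hg.trans_le hgg') hg'1
  refine Real.rpow_le_rpow (by linarith) ?_ hr
  show 1 + Real.log g'⁻¹ ≤ 1 + Real.log g⁻¹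
  have : Real.log g'⁻¹ ≤ Real.log g⁻¹ :=
    Real.log_le_log (inv_pos.mpr (hg.trans_le hgg')) (inv_anti₀ hg hgg')
  linarith

/-- **The collar profile is antitone along the flow, on the window:** `Rcol j ≤ Rcol i` for `i ≤ j ≤ K` (`g_i ≤ g_j ≤ 1`, `r`
antitone, `R₁ ≥ 0`). [cite: Balaban1985UV3, (39) p.266] -/
theorem rcolOf_antitone (K : CarrierConsts) (hR₁ : 0 ≤ K.R₁) (hr : 0 ≤ K.r₀) :
    ∀ i j, i ≤ j → j ≤ S.K → rcolOf S K j ≤ rcolOf S K i := by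
  intro i j hij hj
  unfold rcolOf
  refine Nat.mul_le_mul_right _ (Nat.ceil_mono (mul_le_mul_of_nonneg_left ?_ hR₁))
  exact rFun_antitone hr (gk_pos S i) (gk_mono S hij) (gk_le_one S S.gK_le_one j hj)

/-- **The collar profile against `x(g)^{r₀}`, on the window:** `Rcol i ≤ (R₁ + 1)M₁ · x(g_i)^{r₀}` for `i ≤ K` (`⌈a⌉ ≤ a + 1`,
`x(g_i)^{r₀} ≥ 1`). [cite: Balaban1985UV3, (39) p.266] -/
theorem rcolOf_le (K : CarrierConsts) (hR₁ : 0 ≤ K.R₁) (hr : 0 ≤ K.r₀) :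
    ∀ i, i ≤ S.K → (rcolOf S K i : ℝ) ≤ (K.R₁ + 1) * K.M₁ * xlog (S.gk i) ^ K.r₀ := by
  intro i hi
  have hx : 1 ≤ xlog (S.gk i) := one_le_xlog (gk_pos S i) (gk_le_one S S.gK_le_one i hi)
  have hxr : 1 ≤ xlog (S.gk i) ^ K.r₀ := Real.one_le_rpow hx hr
  have ha : 0 ≤ K.R₁ * B10.rFun K.r₀ (S.gk i) := mul_nonneg hR₁ (by rw [rFun_eq]; linarith)
  have hceil : (⌈K.R₁ * B10.rFun K.r₀ (S.gk i)⌉₊ : ℝ) ≤ K.R₁ * B10.rFun K.r₀ (S.gk i) + 1 :=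
    (Nat.ceil_lt_add_one ha).le
  unfold rcolOf
  push_cast
  rw [rFun_eq] at hceil
  have hM : (0 : ℝ) ≤ K.M₁ := Nat.cast_nonneg _
  calc (⌈K.R₁ * B10.rFun K.r₀ (S.gk i)⌉₊ : ℝ) * K.M₁ ≤ (K.R₁ * xlog (S.gk i) ^ K.r₀ + 1) * K.M₁ :=
        mul_le_mul_of_nonneg_right hceil hM
    _ ≤ ((K.R₁ + 1) * xlog (S.gk i) ^ K.r₀) * K.M₁ := by
        refine mul_le_mul_of_nonneg_right ?_ hM
        nlinarith
    _ = (K.R₁ + 1) * K.M₁ * xlog (S.gk i) ^ K.r₀ := by ring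

/-! ## §2 The booked Z-term coefficients `zcoefOf` on the window -/

/-- The constant `A` of the rate `CZ_j ≤ A·x(g_j)`: `A = (Cz + Cv) + C₅ + C₆ + (|log σ₀| + d(𝔤))·c₁`. [cite: Balaban1985UV3, (41) p.266] -/
theorem zcoefOf_le (K : CarrierConsts) (hCz : 0 ≤ K.Cz + K.Cv) (h5 : 0 ≤ K.C₅) (h6 : 0 ≤ K.C₆) (hc₁ : 0 ≤ K.c₁) :
    ∀ j, j < S.K → zcoefOf S K j ≤ ((K.Cz + K.Cv) + K.C₅ + K.C₆ + (|K.logσ₀| + K.dg) * K.c₁) * xlog (S.gk j) := by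
  intro j hj
  unfold zcoefOf
  exact bookedCZ_le_xlog hCz h5 h6 (abs_nonneg _) K.dg_nonneg hc₁ (gk_pos S j) (gk_le_one S S.gK_le_one j hj.le)

/-- The booked coefficients are nonnegative on the window. [cite: Balaban1985UV3, (41) p.266] -/
theorem zcoefOf_nonneg (K : CarrierConsts) (hCz : 0 ≤ K.Cz + K.Cv) (h5 : 0 ≤ K.C₅) (h6 : 0 ≤ K.C₆) (hc₁ : 0 ≤ K.c₁) :
    ∀ j, j < S.K → 0 ≤ zcoefOf S K j := by
  intro j hj
  unfold zcoefOf
  have hg := gk_pos S j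
  have hu : 0 ≤ Real.log (S.gk j)⁻¹ := B10.log_inv_nonneg_of_le_one hg (gk_le_one S S.gK_le_one j hj.le)
  have := K.dg_nonneg
  have := abs_nonneg K.logσ₀
  have : 0 ≤ (K.Cz + K.Cv) * S.gk j := mul_nonneg hCz hg.le
  positivity

/-! ## §3 `LeafSystem.lf` at the standard tower input -/

open scoped Matrix.Norms.L2Operator

variable {G : Type} [GaugeGroup G] [MeasurableSpace G] [HaarData G] {V : Type} [NormedAddCommGroup V] [NormedSpace ℂ V]

/-- **`B10Assembly.LeafSystem.lf` AT THE LANE'S STANDARD TOWER INPUT `stdTowerInput X K 𝔖`** (LEAF-LEDGER B25; the field type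
literally, for the family's constants `C` in normalised units `C.g = 1`, `C.L = L`, `C.d = 6/log L`).  Every hypothesis of
`…LiftBridge.lf_tower3_avg` that is a fact about the lane's definitions is DISCHARGED here (masses off admissible histories — p1;
collar profile and Z-term coefficients on the window — §1–§2; `|T₁^{(k)}|`, `g_k` — p3).  HYPOTHESES THAT REMAIN, by class:
(α) DATA DISPLAYS about the external expansion datum `U_k(h, ·) = X.UkH` (lead ruling R-DISP, LEAF-LEDGER §F3): `hLF67` = the
history's large-field characteristic function «`|V_j(∂p′) − 1| ≥ g_jp(g_j)`» composed with **(67)** «`Ū_k^j = V_j` on `Λ_j`», read on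
the `j`-fold average of the lift, and **(68)** «`|U_k(∂p) − 1| < O(1)g_jp(g_j)L^{−2j}` on `B^j(Λ_j)`»; the COUPLING WINDOW `g_j ≤ γ₇₁ᴸ`
(«for g_j sufficiently small», p. 273; seat p3's `γ₀`); sign conditions on the constants record (`M₁ ≥ 1`, `R₁, r₀ ≥ 0`, `b₀, p₀ > 0`,
nonnegative Z-term constants); and the provisos NOT IN PRINT (E2: `3r₀ + 2 ≤ 2p₀`, `8A·K_c³/(½log L) ≤ b₀²/(4N)`, `56 ≤ b₀²/(4N)`).
[cite: Balaban1985UV3, pp.273–274, (67)–(68) p.273, (39)–(41) p.266] -/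
theorem lf_stdTowerInput (𝔊 : GroupModel G) (C : B10Assembly.Consts) (hd : C.d = 6 / Real.log C.L) (hCL : C.L = (L : ℝ))
    (hCg : C.g = 1) (hL : 2 ≤ L) (X : ExternalInputs S G) (K : CarrierConsts)
    (𝔖 : ∀ k, StepSeries S G V (nblkOf S K k) k) {C₁ : ℝ}
    -- constants record: signs and sizes
    (hM : 0 < K.M₁) (hR₁ : 0 ≤ K.R₁) (hr : 0 ≤ K.r₀) (hb₀ : 0 < K.b₀) (hp₀ : 0 < K.p₀)
    (hCz : 0 ≤ K.Cz + K.Cv) (h5 : 0 ≤ K.C₅) (h6 : 0 ≤ K.C₆) (hc₁ : 0 ≤ K.c₁) (hC₁ : 0 < C₁)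
    -- coupling window
    (hγ : ∀ j, j < S.K → S.gk j ≤ gamma71L C₁ L K.b₀ K.p₀)
    -- (α) displays about X.UkH: (67)∘large field, (68)
    (hLF67 : ∀ k, k ≤ S.K → ∀ (h : Hist S.P k), Hist.Admissible K.M₁ (rcolOf S K) k h → ∀ (U : GaugeField S.P k G),
      ∀ e ∈ Hist.disc h, S.gk e.1 * B10.pFun K.b₀ K.p₀ (S.gk e.1) ≤
        ‖((hol (avgIter L (liftCfg 𝔊 (X.UkH k h U)) e.1) (codeZ e) (plaqWord e.2.2.1 e.2.2.2) :
            (Matrix (Fin 𝔊.N) (Fin 𝔊.N) ℂ)ˣ) : Matrix (Fin 𝔊.N) (Fin 𝔊.N) ℂ) - 1‖)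
    (h68 : ∀ k, k ≤ S.K → ∀ (h : Hist S.P k), Hist.Admissible K.M₁ (rcolOf S K) k h → ∀ (U : GaugeField S.P k G),
      ∀ e ∈ Hist.disc h,
        pdevOn (loK L e.1 (codeZ e)) (plaqHiK L e.1 (codeZ e) e.2.2.1 e.2.2.2) (liftCfg 𝔊 (X.UkH k h U)) <
          C₁ * (S.gk e.1 * B10.pFun K.b₀ K.p₀ (S.gk e.1)) * (((L : ℝ) ^ e.1)⁻¹) ^ 2)
    -- provisos NOT IN PRINT (E2)
    (hp : K.r₀ * 3 + 2 ≤ 2 * K.p₀)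
    (hb₁ : 8 * ((((K.Cz + K.Cv) + K.C₅ + K.C₆ + (|K.logσ₀| + K.dg) * K.c₁) *
      (2 * (2 * ((K.R₁ + 1) * K.M₁) + 2 * ((L : ℝ) * (3 * ((K.M₁ : ℝ) - 1)) + 3 * ((L : ℝ) - 1)) + 20) * 1) ^ 3 /
      (Real.log C.L / 2))) ≤ 1 / (4 * (𝔊.N : ℝ)) * K.b₀ ^ 2)
    (hb₂ : 56 ≤ 1 / (4 * (𝔊.N : ℝ)) * K.b₀ ^ 2) :
    ∀ k, k ≤ (stdTowerInput X K 𝔖).tower3.toTowerRun.K → ∀ U : (stdTowerInput X K 𝔖).tower3.toTowerRun.Cfg k,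
      (stdTowerInput X K 𝔖).tower3.toTowerRun.LF k U
          (fun h => -((stdTowerInput X K 𝔖).tower3.toTowerRun.mainT k h U) +
            (stdTowerInput X K 𝔖).tower3.toTowerRun.Zterm k h) ≤
        Real.exp (C.d * (stdTowerInput X K 𝔖).tower3.toTowerRun.sites k) := by
  have hA : 0 ≤ (K.Cz + K.Cv) + K.C₅ + K.C₆ + (|K.logσ₀| + K.dg) * K.c₁ := by
    have := K.dg_nonneg
    have := abs_nonneg K.logσ₀
    positivity
  have hρ : (0 : ℝ) ≤ (K.R₁ + 1) * K.M₁ := by positivity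
  refine lf_tower3_avg 𝔊 C hd hCL hL (stdTowerInput X K 𝔖) (gs := 1) (ε := S.g0sq)
    (fun k hk => by exact_mod_cast sites_eq_card S k (by omega))
    (fun k h U hh => stdTowerInput_mass_eq_zero_of_not_admissible X K 𝔖 k h U hh)
    (g0sq_pos S) hC₁ hb₀ hp₀ (fun j => by rw [hCg, hCL]; exact gk_eq_gRun_norm S j) hγ hLF67 h68
    hM (rcolOf_antitone K hR₁ hr) hρ hr (rcolOf_le K hR₁ hr)
    (zcoefOf_nonneg K hCz h5 h6 hc₁) (zcoefOf_le K hCz h5 h6 hc₁) hA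
    (fun j hj => ⟨gk_pos S j, gk_le_one S S.gK_le_one j hj⟩) le_rfl hp hb₁ hb₂

end Summit.QuantumFields.Balaban3D.Proofs.LargeFieldStd

end
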